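import Literature.MathematicalPhysics.QuantumFieldTheory.Balaban1983to89.B9Eq387IMSAveragingLettersLattice
import Literature.MathematicalPhysics.QuantumFieldTheory.Balaban1983to89.B9Eq387IMSPerturbationLetters
import Literature.MathematicalPhysics.QuantumFieldTheory.Balaban1983to89.B9Eq315QLipschitzL2
import Literature.MathematicalPhysics.QuantumFieldTheory.Balaban1983to89.B5Eq172FlatCoercivity

/-!
# `Balaban1983to89.B9Eq387IMSAveragingLettersBackground` — T. Bałaban, *Propagators for lattice gauge theories in a background field*, Commun. Math. Phys.
# **99** (1985) 389–434 [Balaban1985BackgroundPropagators] (3.101)–(3.103) p. 414, p. 408, (3.15)–(3.16) p. 393, (3.78)–(3.79) p. 406, with [Balaban1985Averaging]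
# (124)–(126) p. 36 and [Balaban1984PropagatorsI] (1.118) p. 36: **THE (dn) ROW OF KERNEL 7 FOR `T₃ = √a·Q(U)` AT A SMALL BACKGROUND** — `Q(U) = Q(1) + E′`
# with ONE displayed letter `‖Q(U)f − Q(1)f‖ ≤ θ‖f‖`: `Σ_j ‖Q(U)(χ_S^jf)‖² ≤ ‖Q(U)f‖² + ((√r + θ)(Θ√r + 4θ) + (2Θr + 8θ²))·‖f‖²`, `r = c₁∕(c₀L^d)`, `Θ` the
# sweep energy of the partition (the flat letters of `B9Eq387IMSAveragingLettersLattice` carried through the perturbation dress of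
# `B9Eq387IMSPerturbationLetters`); then `θ := θ_Q = M_φ′M_φ√(2d·c₁∕c₀)·102(d+1)²L·ε_U` PRODUCED by NE9 leaf-02's `B9Eq315QLipschitzL2.norm_QtorusW_sub_flat_le_local`
# and `Θ := 256d(L−1)²∕M₀²` for the tree's `B5SmoothPartition.hS` — instance-ledger rows L5∕L6∕L7 (`i = 3`) of `t4/ROUTES-NE9.md` v13.34 at the chain's
# backgrounds, route R2′ STEP B8′ (S-P7 «IMS assembly»)

statement-level skeleton of published theorems with citation tags; proofs where landed; nothing here is a claim about the Yang–Mills mass gap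

CITATION HEADER (lean-in-tree rule).  Audit cell `pub-balaban`, sub-cell `t4`, BINDER row NE9; filed by NE9 formalisation-swarm LEAF PROVER 01
(`b2b-balaban-t4-ne9-formalise-leaf-01`, gen 82) as the fifth file of the `T₃` series (`B9Eq315QFlatSweep`, `B9Eq3102LeibnizCommutatorAveraging`,
`B9Eq387IMSAveragingLettersLattice` — flat; `B9Eq387IMSPerturbationLetters` — abstract dress; THIS — the chain's backgrounds), over NE9 leaf-02 gen 64's
volume-free `θ_Q`-letter and this lineage's kernel-9 port.  Sources READ by this seat in the held text `paper:balaban1985-cmp99-background-propagators`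
(journal page = PDF page + 388): p. 393 (3.15)–(3.16), p. 408, p. 414 (3.101)–(3.103).

THE PRINT (verbatim, p. 414).  *«(Q_jhA)(c) = h(c₋)(Q_jA)(c) + Σ_b L^{−jd}Q_j(c,b)(∂h)(Γ_{c₋,b₋})A(b) = h(c₋)(Q_jA)(c) + (S_j(∂h)A)(c). (3.102)»*, with the
kernel representation *«(Q_jA)(c) = Σ_{b⊂B^j(c₋)∪B^j(c₊)} L^{−jd}Q_j(c,b)A(b)»* at a GENERAL background.  The tree holds no kernel for `Q(U)` (its `linQcov` is
the derivative of [B7] (122)'s non-linear averaging), only the flat mean ([B7] (125)) and the Lipschitz letter `‖Q(U) − Q(1)‖ ≤ θ_Q` ((3.78)–(3.79)-type,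
`B9Eq315QLipschitzL2`); THIS file therefore does NOT type (3.102) at `U ≠ 1` but bounds the IMS letters of `Q(U)` by those of `Q(1)` plus a `θ_Q`-perturbation
— the route's device, NOT print's; nothing of [B9] is asserted.

WHY (route R2′ STEP B8′, S-P7; instance ledger `t4/ROUTES-NE9.md` v13.34 rows L5∕L6∕L7, `i = 3`).  Kernel 7's assembly runs at the chain's small backgrounds;
the `T₁`∕`T₂` rows are exact at every `U` (NE9 leaf-04's Leibniz letters), the `T₃` row was typed at `U = 1` (parents).  With `Q(U) = Q(1) + E′`, `‖E′‖ ≤ θ_Q`,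
the (dn) shape of `ims_assembly_strong` for `T₃` holds with `tk + a = (t₃ + θ)(k₃ + 4θ) + (2a₃ + 8θ²)`: the `1∕M²`-small part from `Q(1)`'s sweep energy, the
`θ_Q`-small part from the background window; both `η`-free in the chain's reading (`M₀ = M∕η`, `Lη = 1`; `θ_Q`'s own `L`∕window dependence is the supplier's,
displayed).

WHAT IS PROVED (sorry-free; proof lane — no `def`, no `Prop` placeholder; [folklore] composition BY NAME; nothing of [B9] asserted).  Setting: the two parents';
background `U` and the flat one each under the tree's displayed regularity letters (`hα1 hU1 hreg` ∕ `hα1′ hU1′ hreg′`); cutoff CLMs `χ_S^j` ∕ `χ_E^j` acting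
pointwise as `χ_j(b₋)` ∕ `χ_j(π c)`; weights `c₀`, `c₁`.
* §1 **`sum_norm_sq_QtorusW_localised_le`** — `Σ_jχ_j² = 1`, sweep energy `≤ Θ`, `‖Q(U)f − Q(1)f‖ ≤ θ‖f‖` ⟹ `Σ_j ‖Q(U)(χ_S^jf)‖² ≤ ‖Q(U)f‖² +
  ((√r + θ)(Θ√r + 4θ) + (2Θr + 8θ²))‖f‖²` ((D) `sum_norm_sq_apply_localised_le` at `T := Q(U)` as a CLM, `T = T₀ + E′` with `T₀ := Q(1)`, `‖E′‖ ≤ θ` by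
  `opNorm_le_bound`; the partition hypotheses of the perturbation file discharged by (D) §1 `sum_comp_self_eq_one_of_pointwise` ∕ `inner_apply_eq_inner_apply_of_pointwise`).
* §2 **`sum_norm_sq_QtorusW_localised_le_of_window`** (`θ := θ_Q` from `‖U(b) − 1‖ ≤ ε_U`, `U(b) ∈ U1`, block regularity — leaf-02's letter BY NAME),
  **`sum_norm_sq_QtorusW_localised_le_smooth`** (moreover `χ_z = B5SmoothPartition.hS (L·m) M₀`, `Θ = 256d(L−1)²∕M₀²` — the parent's `sum_hS_sweep_sq_le`).
HONEST SCOPE.  Composition + threshold arithmetic; the flat regularity letters are DISCHARGED in §2 by NE9 leaf-03's `B5Eq172FlatCoercivity.hU1_one` ∕ `hreg_one` (`α′ = 0`) and stay displayed only in §1's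
`θ`-letter hypothesis; `θ_Q` carries the supplier's `√(c₁∕c₀)·L` and is small only through `ε_U`; NOT the `W` letter, NOT L11, NOT
the choice of `M₀`; rows of ONE sub-step of a route step, NOT NE9 (cell pub-balaban: NE9 NOT PRINTED ∕ NOT PROVED; «NE9 ⇐ the named binders»; row WALLED ON A MODEL
(O-NE9-1); spine PROVED 0∕9; rung (B)+1 on a finite T⁴ — NOT infinite volume, NOT mass gap, NOT Clay; HONEST DEPENDENCY: continuum YM on T⁴ ⇐ BetaPertH ∧ nine spine
estimates (0/9 proved); BetaPertH ⇐ (D1) ∧ (D4) ∧ CAP+tail; G-an2-4 gates asym, D1 and NE2/3/4).  NEW file importing `B9Eq387IMSAveragingLettersLattice`,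
`B9Eq387IMSPerturbationLetters`, `B9Eq315QLipschitzL2`, `B5Eq172FlatCoercivity`; nothing modified.  Net new unproved facts: 0.
-/

noncomputable section

open scoped BigOperators InnerProductSpace ComplexConjugate
open Finset

namespace Literature.MathematicalPhysics.QuantumFieldTheory.Balaban1983to89.B9Eq387IMSAveragingLettersBackground

open B7Prop1Explicit (U1 Wcx boxVec e)
open B4Sect5Torus (TSite)
open B9SectCLatticeCarrier (Bond bpos)
open B9Eq319QprimeTorus (fineP)
open B9Eq311L2Pairing (WL2)
open B11Eq103H1Complex (BondL2K)
open B9Eq315QTorus (perSite perCfg cornerSite QtorusW)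
open B9Eq315QFlatSweep (norm_QtorusW_one_le)
open B9Eq387IMSAveragingLettersLattice (sum_norm_sq_comm_QtorusW_one_le norm_sum_comm_comm_QtorusW_one_le sum_hS_sweep_sq_le)
open B9Eq387IMSPerturbationLetters (sum_norm_sq_comm_add_le norm_mul_norm_sum_comm_comm_add_le)
open B9Eq387IMSLocalLettersLattice (sum_norm_sq_apply_localised_le sum_comp_self_eq_one_of_pointwise inner_apply_eq_inner_apply_of_pointwise)
open B9Eq315QLipschitzL2 (norm_QtorusW_sub_flat_le_local)

variable {d : ℕ} (L : ℕ) (m : Fin d → ℕ) [∀ i, NeZero (fineP L m i)] (hL : 1 ≤ L)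
  {𝔸 : Type*} [NormedRing 𝔸] [NormOneClass 𝔸] [NormedAlgebra ℂ 𝔸] [CompleteSpace 𝔸]
  (U : Bond d (fineP L m) → 𝔸ˣ) {α : ℝ} (hα1 : α ≤ 1 / 64)
  (hU1 : ∀ (x : B7Prop1Explicit.Site d) (κ : Fin d), perCfg (fineP L m) U x κ ∈ U1 𝔸)
  (hreg : ∀ (y : TSite d m) (κ : Fin d) (r : Fin d → Fin L),
    ‖((Wcx L (perCfg (fineP L m) U) (cornerSite L y) κ (boxVec L r) : 𝔸ˣ) : 𝔸) - 1‖ ≤ α)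
  {α' : ℝ} (hα1' : α' ≤ 1 / 64)
  (hU1' : ∀ (x : B7Prop1Explicit.Site d) (κ : Fin d), perCfg (fineP L m) (fun _ : Bond d (fineP L m) => (1 : 𝔸ˣ)) x κ ∈ U1 𝔸)
  (hreg' : ∀ (y : TSite d m) (κ : Fin d) (r : Fin d → Fin L),
    ‖((Wcx L (perCfg (fineP L m) (fun _ : Bond d (fineP L m) => (1 : 𝔸ˣ))) (cornerSite L y) κ (boxVec L r) : 𝔸ˣ) : 𝔸) - 1‖ ≤ α')
  {W : Type*} [NormedAddCommGroup W] [InnerProductSpace ℂ W] [FiniteDimensional ℂ W] (φ : W ≃ₗ[ℂ] 𝔸) {c₀ c₁ : ℝ} [Fact (0 < c₀)] [Fact (0 < c₁)]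
  {J : Type*} (s : Finset J) (πc : Bond d m → TSite d (fineP L m)) (χ : J → TSite d (fineP L m) → ℝ)
  (χS : J → BondL2K ℂ d (fineP L m) c₀ W →L[ℂ] BondL2K ℂ d (fineP L m) c₀ W) (χE : J → BondL2K ℂ d m c₁ W →L[ℂ] BondL2K ℂ d m c₁ W)
  (hS : ∀ j (f : BondL2K ℂ d (fineP L m) c₀ W) (b : Bond d (fineP L m)), WL2.equiv ℂ _ W (χS j f) b = (χ j (bpos b) : ℂ) • WL2.equiv ℂ _ W f b)
  (hE : ∀ j (g : BondL2K ℂ d m c₁ W) (c : Bond d m), WL2.equiv ℂ _ W (χE j g) c = (χ j (πc c) : ℂ) • WL2.equiv ℂ _ W g c)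

/-! ## §1 The (dn) row of kernel 7 for `Q(U) = Q(1) + E′` from the flat row and ONE displayed letter `‖Q(U)f − Q(1)f‖ ≤ θ‖f‖` -/

include hS hE in
/-- **ROW L5∕L6∕L7 AT THE LATTICE, SMALL BACKGROUND — THE (dn) LETTER OF `Q(U)`**: for a quadratic partition `Σ_j χ_j(x)² = 1` with sweep energy `≤ Θ`
(one-site samplings `χ_S^j` at `b₋`, `χ_E^j` at `π c`), a background whose averaging is `θ`-close to the flat one in operator norm
(`‖Q(U)f − Q(1)f‖ ≤ θ‖f‖`, the tree's `θ_Q`-letter), and every fine 1-form `f`, with `r = c₁∕(c₀L^d)`: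
`Σ_j ‖Q(U)(χ_S^jf)‖² ≤ ‖Q(U)f‖² + ((√r + θ)(Θ√r + 4θ) + (2Θr + 8θ²))·‖f‖²` — (D) §2 at `T := Q(U) = Q(1) + E′` with the flat letters `t₃ = √r`,
`k₃ = Θ√r`, `a₃ = Θr` (`B9Eq387IMSAveragingLettersLattice`) and the perturbation dress (`B9Eq387IMSPerturbationLetters`). [folklore] (IMS localisation)
[cite: Balaban1985BackgroundPropagators, (3.101)–(3.103) p.414, p.408, (3.87)–(3.89) p.409, (3.15) p.393] -/
theorem sum_norm_sq_QtorusW_localised_le (hχ1 : ∀ x, ∑ j ∈ s, χ j x ^ 2 = 1) {Θ θ : ℝ} (hΘ0 : 0 ≤ Θ) (hθ0 : 0 ≤ θ)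
    (hΘ : ∀ (c : Bond d m) (r : Fin d → Fin L) (i : ℕ), i < L →
      ∑ j ∈ s, (χ j (πc c) - χ j (perSite (fineP L m) (cornerSite L c.1 + boxVec L r + (i : ℤ) • e c.2))) ^ 2 ≤ Θ)
    (hθ : ∀ f : BondL2K ℂ d (fineP L m) c₀ W,
      ‖QtorusW L m hL φ U hα1 hU1 hreg (c₁ := c₁) f - QtorusW L m hL φ (fun _ => 1) hα1' hU1' hreg' (c₁ := c₁) f‖ ≤ θ * ‖f‖)
    (f : BondL2K ℂ d (fineP L m) c₀ W) :
    ∑ j ∈ s, ‖QtorusW L m hL φ U hα1 hU1 hreg (c₁ := c₁) (χS j f)‖ ^ 2 ≤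
      ‖QtorusW L m hL φ U hα1 hU1 hreg (c₁ := c₁) f‖ ^ 2 +
        ((Real.sqrt (c₁ / (c₀ * (L : ℝ) ^ d)) + θ) * (Θ * Real.sqrt (c₁ / (c₀ * (L : ℝ) ^ d)) + 4 * θ) +
          (2 * (Θ * (c₁ / (c₀ * (L : ℝ) ^ d))) + 8 * θ ^ 2)) * ‖f‖ ^ 2 := by
  have hc₀ : 0 < c₀ := Fact.out
  have hc₁ : 0 < c₁ := Fact.out
  have hr : 0 ≤ Real.sqrt (c₁ / (c₀ * (L : ℝ) ^ d)) := Real.sqrt_nonneg _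
  -- the operators as CLMs: `T = T₀ + E′`
  set T : BondL2K ℂ d (fineP L m) c₀ W →L[ℂ] BondL2K ℂ d m c₁ W :=
    LinearMap.toContinuousLinearMap (QtorusW L m hL φ U hα1 hU1 hreg (c₁ := c₁)) with hT
  set T₀ : BondL2K ℂ d (fineP L m) c₀ W →L[ℂ] BondL2K ℂ d m c₁ W :=
    LinearMap.toContinuousLinearMap (QtorusW L m hL φ (fun _ => 1) hα1' hU1' hreg' (c₁ := c₁)) with hT₀
  set E' : BondL2K ℂ d (fineP L m) c₀ W →L[ℂ] BondL2K ℂ d m c₁ W := T - T₀ with hE'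
  have hsplit : T = T₀ + E' := by rw [hE']; abel
  have hEθ : ‖E'‖ ≤ θ := ContinuousLinearMap.opNorm_le_bound _ hθ0 fun g => by
    rw [hE', sub_apply]; exact hθ g
  -- the partition hypotheses in the abstract shape of the perturbation file
  have hS1 : ∀ x : BondL2K ℂ d (fineP L m) c₀ W, ∑ j ∈ s, χS j (χS j x) = x := fun x => by
    have h := DFunLike.congr_fun (sum_comp_self_eq_one_of_pointwise s bpos χ χS hS hχ1) x
    simpa using h
  have hE1 : ∀ y : BondL2K ℂ d m c₁ W, ∑ j ∈ s, χE j (χE j y) = y := fun y => by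
    have h := DFunLike.congr_fun (sum_comp_self_eq_one_of_pointwise s πc χ χE hE hχ1) y
    simpa using h
  have hSsa : ∀ j (x x' : BondL2K ℂ d (fineP L m) c₀ W), ⟪χS j x, x'⟫_ℂ = ⟪x, χS j x'⟫_ℂ := fun j x x' =>
    inner_apply_eq_inner_apply_of_pointwise bpos (χS j) (χ j) (hS j) x x'
  have hEsa : ∀ j (y y' : BondL2K ℂ d m c₁ W), ⟪χE j y, y'⟫_ℂ = ⟪y, χE j y'⟫_ℂ := fun j y y' =>
    inner_apply_eq_inner_apply_of_pointwise πc (χE j) (χ j) (hE j) y y'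
  -- the flat letters
  have hAD₀ : ∀ x, ∑ j ∈ s, ‖χE j (T₀ x) - T₀ (χS j x)‖ ^ 2 ≤ Θ * (c₁ / (c₀ * (L : ℝ) ^ d)) * ‖x‖ ^ 2 := fun x =>
    sum_norm_sq_comm_QtorusW_one_le L m hL hα1' hU1' hreg' φ s πc χ χS χE hS hE hΘ0 hΘ x
  have hT₀ : ∀ x, ‖T₀ x‖ ≤ Real.sqrt (c₁ / (c₀ * (L : ℝ) ^ d)) * ‖x‖ := fun x => norm_QtorusW_one_le L m hL hα1' hU1' hreg' φ x
  have hK₀ : ∀ x, ‖∑ j ∈ s, ((χE j (χE j (T₀ x) - T₀ (χS j x))) - (χE j (T₀ (χS j x)) - T₀ (χS j (χS j x))))‖ ≤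
      Θ * Real.sqrt (c₁ / (c₀ * (L : ℝ) ^ d)) * ‖x‖ := fun x =>
    norm_sum_comm_comm_QtorusW_one_le L m hL hα1' hU1' hreg' φ s πc χ χS χE hS hE hΘ0 hΘ x
  -- the perturbed letters
  have hAD : ∀ x, ∑ j ∈ s, ‖χE j (T x) - T (χS j x)‖ ^ 2 ≤ (2 * (Θ * (c₁ / (c₀ * (L : ℝ) ^ d))) + 8 * θ ^ 2) * ‖x‖ ^ 2 := fun x => by
    rw [hsplit]
    refine (sum_norm_sq_comm_add_le s χS χE hS1 hSsa hE1 hEsa T₀ E' hAD₀ x).trans ?_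
    have h8 : 8 * ‖E'‖ ^ 2 ≤ 8 * θ ^ 2 := by nlinarith [norm_nonneg E', hEθ]
    nlinarith [sq_nonneg ‖x‖, h8]
  have hTK : ∀ x, ‖T x‖ * ‖∑ j ∈ s, ((χE j (χE j (T x) - T (χS j x))) - (χE j (T (χS j x)) - T (χS j (χS j x))))‖ ≤
      (Real.sqrt (c₁ / (c₀ * (L : ℝ) ^ d)) + θ) * (Θ * Real.sqrt (c₁ / (c₀ * (L : ℝ) ^ d)) + 4 * θ) * ‖x‖ ^ 2 := fun x => by
    rw [hsplit]
    refine (norm_mul_norm_sum_comm_comm_add_le s χS χE hS1 hSsa hE1 hEsa T₀ E' hr hT₀ hK₀ x).trans ?_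
    have h1 : Real.sqrt (c₁ / (c₀ * (L : ℝ) ^ d)) + ‖E'‖ ≤ Real.sqrt (c₁ / (c₀ * (L : ℝ) ^ d)) + θ := by linarith
    have h2 : Θ * Real.sqrt (c₁ / (c₀ * (L : ℝ) ^ d)) + 4 * ‖E'‖ ≤ Θ * Real.sqrt (c₁ / (c₀ * (L : ℝ) ^ d)) + 4 * θ := by linarith
    have h0 : 0 ≤ Real.sqrt (c₁ / (c₀ * (L : ℝ) ^ d)) + ‖E'‖ := by positivity
    have h0' : 0 ≤ Θ * Real.sqrt (c₁ / (c₀ * (L : ℝ) ^ d)) + 4 * ‖E'‖ := by positivity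
    exact mul_le_mul_of_nonneg_right (mul_le_mul h1 h2 h0' (h0.trans h1)) (sq_nonneg _)
  exact sum_norm_sq_apply_localised_le s bpos πc χ χS χE hS hE hχ1 T hAD hTK f

/-! ## §2 The tree's letters: `θ = θ_Q` from `B9Eq315QLipschitzL2`, `Θ = 256d(L−1)²∕M₀²` for `B5SmoothPartition.hS` -/

section Tree

open B5TorusCover (Ctr)
open B5SmoothPartition (sum_hS_sq)

variable {εU : ℝ} (hεU : 0 ≤ εU) (hUε : ∀ b : Bond d (fineP L m), ‖(U b : 𝔸) - 1‖ ≤ εU)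
  {Mφ Mφ' : ℝ} (hMφ : 0 ≤ Mφ) (hφ : ∀ w, ‖φ w‖ ≤ Mφ * ‖w‖) (hMφ' : 0 ≤ Mφ') (hφ' : ∀ X, ‖φ.symm X‖ ≤ Mφ' * ‖X‖)

include hS hE hεU hUε hMφ hφ hMφ' hφ' in
/-- **THE SAME WITH THE TREE's `θ_Q`-LETTER PRODUCED** (`θ := M_φ′M_φ√(2d·c₁∕c₀)·102(d+1)²L·ε_U`, NE9 leaf-02's `B9Eq315QLipschitzL2.norm_QtorusW_sub_flat_le_local`):
the (dn) row of `Q(U)` for EVERY unit-bounded, block-regular background with bond window `‖U(b) − 1‖ ≤ ε_U`. [folklore]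
[cite: Balaban1985BackgroundPropagators, (3.101)–(3.103) p.414, p.408, (3.15) p.393, (3.78)–(3.79) p.406; Balaban1985Averaging, (124)–(126) p.36] -/
theorem sum_norm_sq_QtorusW_localised_le_of_window (hχ1 : ∀ x, ∑ j ∈ s, χ j x ^ 2 = 1) {Θ : ℝ} (hΘ0 : 0 ≤ Θ)
    (hΘ : ∀ (c : Bond d m) (r : Fin d → Fin L) (i : ℕ), i < L →
      ∑ j ∈ s, (χ j (πc c) - χ j (perSite (fineP L m) (cornerSite L c.1 + boxVec L r + (i : ℤ) • e c.2))) ^ 2 ≤ Θ)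
    (f : BondL2K ℂ d (fineP L m) c₀ W) :
    ∑ j ∈ s, ‖QtorusW L m hL φ U hα1 hU1 hreg (c₁ := c₁) (χS j f)‖ ^ 2 ≤
      ‖QtorusW L m hL φ U hα1 hU1 hreg (c₁ := c₁) f‖ ^ 2 +
        ((Real.sqrt (c₁ / (c₀ * (L : ℝ) ^ d)) + Mφ' * Mφ * Real.sqrt (2 * d * c₁ / c₀) * (102 * (d + 1) ^ 2 * L * εU)) *
            (Θ * Real.sqrt (c₁ / (c₀ * (L : ℝ) ^ d)) + 4 * (Mφ' * Mφ * Real.sqrt (2 * d * c₁ / c₀) * (102 * (d + 1) ^ 2 * L * εU))) +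
          (2 * (Θ * (c₁ / (c₀ * (L : ℝ) ^ d))) + 8 * (Mφ' * Mφ * Real.sqrt (2 * d * c₁ / c₀) * (102 * (d + 1) ^ 2 * L * εU)) ^ 2)) * ‖f‖ ^ 2 := by
  haveI : NeZero L := ⟨by omega⟩
  have h0 : (0 : ℝ) ≤ 1 / 64 := by norm_num
  exact sum_norm_sq_QtorusW_localised_le L m hL U hα1 hU1 hreg h0 (B5Eq172FlatCoercivity.hU1_one L m) (B5Eq172FlatCoercivity.hreg_one L m) φ s πc χ χS χE hS hE hχ1
    hΘ0 (by positivity) hΘ (fun g => norm_QtorusW_sub_flat_le_local L m hL U hα1 hU1 hreg h0 (B5Eq172FlatCoercivity.hU1_one L m) (B5Eq172FlatCoercivity.hreg_one L m)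
      hεU hUε φ hMφ hφ hMφ' hφ' g) f

include hεU hUε hMφ hφ hMφ' hφ' in
/-- **ROW L5∕L6∕L7 FOR THE TREE's PARTITION AT A SMALL BACKGROUND**: `χ_z = B5SmoothPartition.hS (L·m) M₀` sampled at `b₋` ∕ at the block corner `L·c₋`,
`Θ = 256d(L−1)²∕M₀²` (`B9Eq387IMSAveragingLettersLattice.sum_hS_sweep_sq_le`), `θ = θ_Q`: the (dn) row of `Q(U)` with every letter PRODUCED but the
background's three displayed regularity facts and its bond window (the flat background's letters discharged by `B5Eq172FlatCoercivity.hU1_one` ∕ `hreg_one`, `α′ = 0`). [folklore]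
[cite: Balaban1985BackgroundPropagators, (3.101)–(3.103) p.414, p.408, (3.15) p.393; Balaban1984PropagatorsI, (1.118) p.36] -/
theorem sum_norm_sq_QtorusW_localised_le_smooth {M₀ : ℕ} (hM : 1 ≤ M₀) (hdiv : ∀ i, M₀ ∣ fineP L m i) (h2N : ∀ i, 2 * M₀ ≤ fineP L m i)
    (χS' : Ctr (fineP L m) M₀ → BondL2K ℂ d (fineP L m) c₀ W →L[ℂ] BondL2K ℂ d (fineP L m) c₀ W)
    (χE' : Ctr (fineP L m) M₀ → BondL2K ℂ d m c₁ W →L[ℂ] BondL2K ℂ d m c₁ W)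
    (hχS : ∀ z (f : BondL2K ℂ d (fineP L m) c₀ W) (b : Bond d (fineP L m)),
      WL2.equiv ℂ _ W (χS' z f) b = (B5SmoothPartition.hS (fineP L m) M₀ z (bpos b) : ℂ) • WL2.equiv ℂ _ W f b)
    (hχE : ∀ z (g : BondL2K ℂ d m c₁ W) (c : Bond d m),
      WL2.equiv ℂ _ W (χE' z g) c = (B5SmoothPartition.hS (fineP L m) M₀ z (perSite (fineP L m) (cornerSite L c.1)) : ℂ) • WL2.equiv ℂ _ W g c)
    (f : BondL2K ℂ d (fineP L m) c₀ W) :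
    ∑ z : Ctr (fineP L m) M₀, ‖QtorusW L m hL φ U hα1 hU1 hreg (c₁ := c₁) (χS' z f)‖ ^ 2 ≤
      ‖QtorusW L m hL φ U hα1 hU1 hreg (c₁ := c₁) f‖ ^ 2 +
        ((Real.sqrt (c₁ / (c₀ * (L : ℝ) ^ d)) + Mφ' * Mφ * Real.sqrt (2 * d * c₁ / c₀) * (102 * (d + 1) ^ 2 * L * εU)) *
            (256 * d * ((L : ℝ) - 1) ^ 2 / (M₀ : ℝ) ^ 2 * Real.sqrt (c₁ / (c₀ * (L : ℝ) ^ d)) +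
              4 * (Mφ' * Mφ * Real.sqrt (2 * d * c₁ / c₀) * (102 * (d + 1) ^ 2 * L * εU))) +
          (2 * (256 * d * ((L : ℝ) - 1) ^ 2 / (M₀ : ℝ) ^ 2 * (c₁ / (c₀ * (L : ℝ) ^ d))) +
            8 * (Mφ' * Mφ * Real.sqrt (2 * d * c₁ / c₀) * (102 * (d + 1) ^ 2 * L * εU)) ^ 2)) * ‖f‖ ^ 2 :=
  sum_norm_sq_QtorusW_localised_le_of_window L m hL U hα1 hU1 hreg φ Finset.univ
    (fun c => perSite (fineP L m) (cornerSite L c.1)) (B5SmoothPartition.hS (fineP L m) M₀) χS' χE' (fun z => hχS z) (fun z => hχE z)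
    hεU hUε hMφ hφ hMφ' hφ' (fun x => sum_hS_sq hM hdiv h2N x) (by positivity) (fun c r i hi => sum_hS_sweep_sq_le L m hM hdiv h2N c r hi) f

end Tree

end Literature.MathematicalPhysics.QuantumFieldTheory.Balaban1983to89.B9Eq387IMSAveragingLettersBackground

end
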